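import Summits.NavierStokesRegularity.NavierStokesRegularity.Theorems.CertifiedBlowupCertifiedBlowupAxisymBlowupBlowupSet
import HarnessLib

/-!
# Far-field regularity persists up to the lifespan of every witness of the crux
# `CertifiedBlowupAxisymBlowup`

Theorems file landed `--supports stmt-NavierStokesRegularity-0727`, line `compact-amplification`
(continuation lead c4, wave 2; registered stub `farField_bound_of_isMaximalSmoothSolution`). A
witness of the crux is a viscosity `ν > 0`, a time `T > 0` and a maximal smooth solution `(u, p)` of
the unforced Navier–Stokes system of lifespan `T`, Leray–Hopf on `[0, T]` from its rapidly decaying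
axisymmetric datum `u 0`. This file proves, from PROVED tree theorems only, that every such solution
is UNIFORMLY BOUNDED on `[0, T) × {‖x‖ ≥ R}` for some radius `R`:

* near the final time and outside a large ball the solution is bounded
  (`axisymmetricL3_boundedNearTop_infinity`: ε-regularity on the tails of the energy class,
  Lemarié-Rieusset 2016 Thm. 14.4 / Robinson–Rodrigo–Sadowski 2016 Lemma 15.12, over the standing
  hypotheses `AxisymmetricL3Hyp` supplied by `axisymmetricL3Hyp_of_lerayHopf_classical`);
* on every closed sub-slab `[0, T'] × ℝ³`, `T' < T`, it is bounded everywhere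
  (`bounded_before_of_lerayHopf_classical`).

Gluing the two on `T' = T - r² / 2` gives `farField_bound_of_lerayHopf_classical` (classical
solutions on `[0, T)`, no maximality needed) and the registered form
`farField_bound_of_isMaximalSmoothSolution`. Consequence for route `CertifiedBlowup`: a certified
computation may legitimately truncate the spatial domain to a fixed ball all the way up to the
blow-up time; for route `SwirlThreshold` (#5): the zoom lives in a fixed ball.

No new definitions, no named-fact hypotheses, no `sorry`.

## References

* P. G. Lemarié-Rieusset, *The Navier–Stokes Problem in the 21st Century*, CRC 2016, Thm. 14.4
  p. 505. [LemarieRieusset2016]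
* J. C. Robinson, J. L. Rodrigo, W. Sadowski, *The Three-Dimensional Navier–Stokes Equations*,
  CUP 2016, Lemma 15.12. [RobinsonRodrigoSadowski2016]
* Z. Bradshaw, T.-P. Tsai, Comm. PDE 45 (2020), §1 (far-field regularity). [BradshawTsai2020]
-/

-- the summit and its single problem share the name (D-0017 nested layout)
set_option linter.dupNamespace false

noncomputable section

open MeasureTheory Set Function Filter Topology Metric
open scoped ENNReal NNReal

namespace Summit.NavierStokesRegularity.NavierStokesRegularity.Theorems.CertifiedBlowupAxisymBlowup.CompactAmplification

open Literature.Analysis Literature.Analysis.FluidPDE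

section Witness

variable {ν T : ℝ} {u : ℝ → EuclideanSpace ℝ (Fin 3) → EuclideanSpace ℝ (Fin 3)}
  {p : ℝ → EuclideanSpace ℝ (Fin 3) → ℝ}

/-- **Far-field bound of a classical Leray–Hopf solution on `[0, T)`.** A classical solution of the
unforced Navier–Stokes system on `[0, T)`, Leray–Hopf on `[0, T]` from a rapidly decaying
axisymmetric datum, is uniformly bounded on `[0, T) × {‖x‖ ≥ R}` for some `R`: bounded near `T`
outside a large ball (`axisymmetricL3_boundedNearTop_infinity`, on `(T - r², T)`), and bounded
everywhere on the closed sub-slab `[0, T - r²/2]` (`bounded_before_of_lerayHopf_classical`).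
[cite: LemarieRieusset2016, Thm. 14.4 p. 505] -/
theorem farField_bound_of_lerayHopf_classical (hν : 0 < ν) (hT : 0 < T)
    (hcl : IsClassicalNSSolutionOn (Ico 0 T) ν 0 u p) (hLH : IsLerayHopfOn T ν 0 (u 0) u)
    (hdec : HasRapidSpatialDecay (u 0)) (haxi : IsAxisymmetric (u 0)) :
    ∃ R K : ℝ, ∀ t ∈ Ico 0 T, ∀ x : EuclideanSpace ℝ (Fin 3), R ≤ ‖x‖ → ‖u t x‖ ≤ K := by
  obtain ⟨R, r, K, hr, hK⟩ := axisymmetricL3_boundedNearTop_infinity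
    (axisymmetricL3Hyp_of_lerayHopf_classical hν hT hcl hLH hdec haxi)
  -- the earlier closed slab `[0, T - r²/2]`, bounded everywhere
  set T₁ : ℝ := T - r ^ 2 / 2 with hT₁_def
  have hT₁T : T₁ < T := by rw [hT₁_def]; nlinarith
  obtain ⟨M, hM⟩ := bounded_before_of_lerayHopf_classical hν hcl hLH hdec haxi T₁ hT₁T
  refine ⟨R, max M K, fun t ht x hx => ?_⟩
  rcases le_or_gt t T₁ with h | h
  · exact (hM t ⟨ht.1, h⟩ x).trans (le_max_left _ _)
  · have ht' : t ∈ Ioo (T - r ^ 2) T := ⟨by rw [hT₁_def] at h; nlinarith, ht.2⟩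
    exact (hK t ht' x hx).trans (le_max_right _ _)

end Witness

/-- **Far-field regularity persists up to the lifespan of every witness of the crux** (registered
stub of stmt-NavierStokesRegularity-0727): for a maximal Leray–Hopf classical solution `(u, p)` of
viscosity `ν > 0` and finite lifespan `T` from a rapidly decaying axisymmetric datum there are `R`
and `K` with `‖u t x‖ ≤ K` for all `t ∈ [0, T)` and all `‖x‖ ≥ R` — the blow-up, if any, is
confined to a fixed ball for the whole lifespan (`farField_bound_of_lerayHopf_classical` applied to
the classical-solution field of maximality). [cite: LemarieRieusset2016, Thm. 14.4 p. 505] -/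
theorem farField_bound_of_isMaximalSmoothSolution : ∀ {ν T : ℝ} {u : ℝ → EuclideanSpace ℝ (Fin 3) → EuclideanSpace ℝ (Fin 3)} {p : ℝ → EuclideanSpace ℝ (Fin 3) → ℝ}, 0 < ν → 0 < T → IsMaximalSmoothSolution ν 0 u p T → IsLerayHopfOn T ν 0 (u 0) u → HasRapidSpatialDecay (u 0) → IsAxisymmetric (u 0) → ∃ R K : ℝ, ∀ t ∈ Set.Ico 0 T, ∀ x : EuclideanSpace ℝ (Fin 3), R ≤ ‖x‖ → ‖u t x‖ ≤ K := by
  intro ν T u p hν hT hmax hLH hdec haxi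
  exact farField_bound_of_lerayHopf_classical hν hT hmax.1 hLH hdec haxi

end Summit.NavierStokesRegularity.NavierStokesRegularity.Theorems.CertifiedBlowupAxisymBlowup.CompactAmplification

end
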